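import Literature.Barriers.MatrixMultiplication.UniversalMethodBarrierSliceRank
import Literature.Barriers.MatrixMultiplication.IrreversibilityBarrier
import Literature.Barriers.MatrixMultiplication.TricoloredSumFreeBarrier
import HarnessLib

/-!
# Counting words by class type; the finite slice-rank bound for powers of `CW_q` (Alman 2021, Thm. 3.4 / §4.1)

Topic `Literature/Barriers/MatrixMultiplication`; part of the PROOF of `UniversalMethodBarrier`
(Alman 2021), milestone "Thm. 1.3". Alman bounds `S̃(CW_q)` by Thm. 3.4 (partition method) and
Prop. 3.8 (symmetrisation); what his proof of Thm. 3.4 actually delivers — and what the Universal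
Method argument consumes — is a bound on every power, `S(CW_q^{⊗m}) ≤ poly(m) · B^m` with
`B = sup_{v ∈ [0,1/3]} g_q(v)`, `g_q(v) = q^{2/3-2v} / (v^v (2/3-2v)^{2/3-2v} (1/3+v)^{1/3+v})`
(§4.1). This file PROVES that finite form: `sliceRank_cwPow_le`. (The supremum
`S̃ = sup_n S(T^{⊗n})^{1/n}` as printed and vendored is NOT bounded by `B` in general — already
`S(CW_1) = 3 > 2.7551` — which is why Thm. 1.3 is proved from the finite form and not from
`Alman2021_thm29`.)

## Content

* `wordType cl A` (class type `k ↦ #{i | cl (A i) = k}` of a word for a 3-colouring `cl`),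
  `classSize`, `wordType_eq_sum`, `sum_wordType`, `prod_weight_eq`, `sum_weight_le`,
  `card_wordType_le` — **the weight-counting bound** `#{A | type A = η} ≤ Π_k (|C_k|/π_k)^{η_k}` for
  every sub-probability vector `π` positive on the support of `η` (give letter `x` the weight
  `π_{cl x}/|C_{cl x}|`; total weight of all words `≤ 1`). This elementary form of the entropy bound
  on multinomial coefficients needs neither multinomials nor concavity: Gibbs' inequality is built in
  by the freedom in `π`.
* `cwClass q` (`X₀ = {x₀}`, `X₁ = {x₁..x_q}`, `X₂ = {x_{q+1}}`), `cwClass_eq_*_iff`,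
  `classSize_cwClass` (`1, q, 1`), `cwClass_sum_eq_two_of_ne_zero` (the support of `CW_q` lies in the
  blocks `002,020,200,011,101,110`), `bigCwTensor_eq_one_of_ne_zero`, `cwPow_support`,
  `cwPow_eq_one_of_ne_zero`, `class_indicator_identities`, `cwPow_wordType_sums` — on the support of
  `CW_q^{⊗m}` with `S_c` corner positions the three directions together use class `2` `S_c` times,
  class `1` `2(m-S_c)` times, class `0` `m+S_c` times (Alman's symmetric distributions, §4.1).
* `cwBase q v = g_q(v)` (real powers, `0^0 = 1`), `cwBase_nonneg`, `typeCount`,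
  `min_typeCount_le_cwBase_pow` — **per support triple `(A,B,C)` one of the three type counts is
  `≤ g_q(S_c/3m)^m`** (weight-count all three directions with the SAME averaged distribution
  `π̄ = (1/3+v, 2/3-2v, v)`; the product of the three bounds is `g_q(v)^{3m}`; this replaces
  Prop. 3.8), `card_image_wordType_le`, `card_typeCount_le`, and
  `sliceRank_cwPow_le` — **`S(CW_q^{⊗m}) ≤ 3(1 + (m+1)³ Bᵐ)` whenever `g_q ≤ B` on `[0,1/3]`**, by
  the covering lemma `hasSliceRankLE_of_cover` of `SliceRankMethod.lean` (cover the support by the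
  words of small type count in each direction).

## References

* J. Alman, Theory of Computing 17 (2021), §2.7, Thm. 3.4 (proof, pp. 16–17), Prop. 3.8, §4.1
  (held: `doi-10-4086-toc-2021-v017a001`). [Alman2021]
* Blasiak–Church–Cohn–Grochow–Naslund–Sawin–Umans 2017, Thm. 4.10 (the covering argument), as
  formalised in `Literature/Combinatorics/Additive/SliceRankMethod.lean`.
-/

noncomputable section

open scoped BigOperators

namespace Literature.Barriers.MatrixMultiplication

open Literature.Computability.AlgebraicComplexity

universe u

/-! ## Words of a given class type: the weight-counting bound -/

section WordCount

variable {X : Type*} [Fintype X]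

/-- The **class type** of a word `A : Fin m → X` for a classification `cl : X → Fin 3`:
`k ↦ #{i | cl (A i) = k}`. [cite: Alman2021, Thm. 3.4 (proof)] -/
def wordType (cl : X → Fin 3) {m : ℕ} (A : Fin m → X) : Fin 3 → ℕ :=
  fun k => (Finset.univ.filter fun i => cl (A i) = k).card

/-- The size of class `k`. [folklore] -/
def classSize (cl : X → Fin 3) (k : Fin 3) : ℕ := (Finset.univ.filter fun x => cl x = k).card

omit [Fintype X] in
/-- The class type, as a sum of indicators. [folklore] -/
theorem wordType_eq_sum (cl : X → Fin 3) {m : ℕ} (A : Fin m → X) (k : Fin 3) :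
    (wordType cl A k : ℕ) = ∑ i, if cl (A i) = k then 1 else 0 := by
  rw [wordType, Finset.card_filter]

/-- A word with a letter count in an empty class does not exist. [folklore] -/
theorem wordType_eq_zero_of_classSize_eq_zero (cl : X → Fin 3) {m : ℕ} (A : Fin m → X) {k : Fin 3}
    (hk : classSize cl k = 0) : wordType cl A k = 0 := by
  rw [wordType, Finset.card_eq_zero, Finset.filter_eq_empty_iff]
  intro i _ hi
  rw [classSize, Finset.card_eq_zero, Finset.filter_eq_empty_iff] at hk
  exact hk (Finset.mem_univ (A i)) hi

/-- The weight of a word under letter weights `w`: grouped by classes it is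
`Π_k (π_k / |C_k|)^{type_k}` when `w x = π (cl x) / |C_{cl x}|`. [folklore] -/
theorem prod_weight_eq (cl : X → Fin 3) (π : Fin 3 → ℝ) {m : ℕ} (A : Fin m → X) :
    (∏ i, π (cl (A i)) / (classSize cl (cl (A i)) : ℝ)) =
      ∏ k, (π k / (classSize cl k : ℝ)) ^ wordType cl A k := by
  rw [← Finset.prod_fiberwise_of_maps_to (g := fun i => cl (A i)) (t := Finset.univ)
    (fun i _ => Finset.mem_univ _)]
  refine Finset.prod_congr rfl fun k _ => ?_
  rw [wordType, ← Finset.prod_const]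
  refine Finset.prod_congr rfl fun i hi => ?_
  rw [(Finset.mem_filter.1 hi).2]

/-- The total letter weight is at most `Σ_k π_k`. [folklore] -/
theorem sum_weight_le (cl : X → Fin 3) (π : Fin 3 → ℝ) (hπ : ∀ k, 0 ≤ π k) :
    (∑ x, π (cl x) / (classSize cl (cl x) : ℝ)) ≤ ∑ k, π k := by
  rw [← Finset.sum_fiberwise_of_maps_to (g := cl) (t := Finset.univ) (fun x _ => Finset.mem_univ _)]
  refine Finset.sum_le_sum fun k _ => ?_
  have hconst : ∀ x ∈ Finset.univ.filter (fun x => cl x = k),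
      π (cl x) / (classSize cl (cl x) : ℝ) = π k / (classSize cl k : ℝ) := fun x hx => by
    rw [(Finset.mem_filter.1 hx).2]
  rw [Finset.sum_congr rfl hconst, Finset.sum_const, nsmul_eq_mul]
  have hcs : (Finset.univ.filter fun x => cl x = k).card = classSize cl k := rfl
  rw [hcs]
  rcases Nat.eq_zero_or_pos (classSize cl k) with h0 | hpos
  · rw [h0, Nat.cast_zero, zero_mul]; exact hπ k
  · have hne : (classSize cl k : ℝ) ≠ 0 := Nat.cast_ne_zero.2 hpos.ne'
    rw [mul_comm, div_mul_cancel₀ _ hne]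

/-- **Counting words of a given class type by weights** (the elementary form of the entropy
bound on multinomial coefficients): for any non-negative `π` with `Σ_k π_k ≤ 1`, positive on the
classes that occur in the type `η`,
`#{A : [m] → X | type(A) = η} ≤ Π_k (|C_k| / π_k)^{η_k}`. (Give letter `x` the weight
`π_{cl x}/|C_{cl x}|`; the total weight of all words is `(Σ_x w_x)^m ≤ 1`, and each word of type `η`
weighs `Π_k (π_k/|C_k|)^{η_k}`.) [cite: Alman2021, Thm. 3.4 (proof)] -/
theorem card_wordType_le (cl : X → Fin 3) (π : Fin 3 → ℝ) (hπ : ∀ k, 0 ≤ π k)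
    (hπ1 : ∑ k, π k ≤ 1) {m : ℕ} (η : Fin 3 → ℕ) (hpos : ∀ k, η k ≠ 0 → 0 < π k) :
    ((Finset.univ.filter fun A : Fin m → X => wordType cl A = η).card : ℝ) ≤
      ∏ k, ((classSize cl k : ℝ) / π k) ^ η k := by
  set W : Finset (Fin m → X) := Finset.univ.filter fun A => wordType cl A = η with hW
  -- if a needed class is empty, there are no such words
  by_cases hempty : ∃ k, η k ≠ 0 ∧ classSize cl k = 0
  · obtain ⟨k, hk, hck⟩ := hempty
    have : W = ∅ := by
      rw [hW, Finset.filter_eq_empty_iff]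
      intro A _ hA
      have := wordType_eq_zero_of_classSize_eq_zero cl A hck
      rw [hA] at this
      exact hk this
    rw [this, Finset.card_empty, Nat.cast_zero]
    exact Finset.prod_nonneg fun k _ => pow_nonneg (div_nonneg (Nat.cast_nonneg _) (hπ k)) _
  push Not at hempty
  -- the weight of a word of type `η`
  set c : ℝ := ∏ k, (π k / (classSize cl k : ℝ)) ^ η k with hc
  have hcpos : 0 < c := by
    refine Finset.prod_pos fun k _ => ?_
    rcases Nat.eq_zero_or_pos (η k) with h0 | hk
    · rw [h0, pow_zero]; exact zero_lt_one
    · have h1 := hpos k hk.ne'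
      have h2 : 0 < classSize cl k := Nat.pos_of_ne_zero (hempty k hk.ne')
      exact pow_pos (div_pos h1 (by exact_mod_cast h2)) _
  -- total weight ≤ 1
  have htotal : (∑ A : Fin m → X, ∏ i, π (cl (A i)) / (classSize cl (cl (A i)) : ℝ)) ≤ 1 := by
    have hpow := Fintype.sum_pow (fun x => π (cl x) / (classSize cl (cl x) : ℝ)) m
    rw [← hpow]
    have h0 : 0 ≤ ∑ x, π (cl x) / (classSize cl (cl x) : ℝ) :=
      Finset.sum_nonneg fun x _ => div_nonneg (hπ _) (Nat.cast_nonneg _)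
    exact pow_le_one₀ h0 ((sum_weight_le cl π hπ).trans hπ1)
  have hconstW : ∀ A ∈ W, (∏ i, π (cl (A i)) / (classSize cl (cl (A i)) : ℝ)) = c :=
    fun A hA => by rw [prod_weight_eq, (Finset.mem_filter.1 hA).2]
  have hsub : (W.card : ℝ) * c ≤ 1 :=
    calc (W.card : ℝ) * c = ∑ _A ∈ W, c := by rw [Finset.sum_const, nsmul_eq_mul]
      _ = ∑ A ∈ W, ∏ i, π (cl (A i)) / (classSize cl (cl (A i)) : ℝ) :=
          (Finset.sum_congr rfl hconstW).symm
      _ ≤ ∑ A : Fin m → X, ∏ i, π (cl (A i)) / (classSize cl (cl (A i)) : ℝ) :=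
          Finset.sum_le_sum_of_subset_of_nonneg (Finset.filter_subset _ _)
            fun (A : Fin m → X) _ _ =>
              Finset.prod_nonneg fun i _ => div_nonneg (hπ _) (Nat.cast_nonneg _)
      _ ≤ 1 := htotal
  have hinv : c⁻¹ = ∏ k, ((classSize cl k : ℝ) / π k) ^ η k := by
    rw [hc, ← Finset.prod_inv_distrib]
    exact Finset.prod_congr rfl fun k _ => by rw [← inv_pow, inv_div]
  rw [← hinv, inv_eq_one_div, le_div_iff₀ hcpos]
  exact hsub

end WordCount

/-! ## The classes of `CW_q` and the support of its powers -/

section CwSupport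

/-- The three classes of coordinates of `CW_q` (Alman 2021, §4.1: `X₀ = {x₀}`, `X₁ = {x₁,…,x_q}`,
`X₂ = {x_{q+1}}`). [cite: Alman2021, §4.1] -/
def cwClass (q : ℕ) : Fin (q + 2) → Fin 3 :=
  fun a => if a = 0 then 0 else if a = Fin.last (q + 1) then 2 else 1

/-- Class `0` is `{x₀}`. [cite: Alman2021, §4.1] -/
theorem cwClass_eq_zero_iff (q : ℕ) (a : Fin (q + 2)) : cwClass q a = 0 ↔ a = 0 := by
  unfold cwClass
  by_cases h1 : a = 0
  · simp [h1]
  · by_cases h2 : a = Fin.last (q + 1) <;> simp [h1, h2]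

/-- Class `2` is `{x_{q+1}}`. [cite: Alman2021, §4.1] -/
theorem cwClass_eq_two_iff (q : ℕ) (a : Fin (q + 2)) : cwClass q a = 2 ↔ a = Fin.last (q + 1) := by
  unfold cwClass
  have hl : (Fin.last (q + 1) : Fin (q + 2)) ≠ 0 := by simp [Fin.ext_iff]
  by_cases h1 : a = 0
  · subst h1; simp [hl.symm]
  · by_cases h2 : a = Fin.last (q + 1) <;> simp [h1, h2]

/-- Class `1` is `{x₁, …, x_q}`. [cite: Alman2021, §4.1] -/
theorem cwClass_eq_one_iff (q : ℕ) (a : Fin (q + 2)) :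
    cwClass q a = 1 ↔ a ≠ 0 ∧ a ≠ Fin.last (q + 1) := by
  unfold cwClass
  by_cases h1 : a = 0
  · simp [h1]
  · by_cases h2 : a = Fin.last (q + 1) <;> simp [h1, h2]

/-- Class sizes `|X₀| = 1`, `|X₁| = q`, `|X₂| = 1`. [cite: Alman2021, §4.1] -/
theorem classSize_cwClass (q : ℕ) :
    classSize (cwClass q) 0 = 1 ∧ classSize (cwClass q) 1 = q ∧ classSize (cwClass q) 2 = 1 := by
  have hl : (Fin.last (q + 1) : Fin (q + 2)) ≠ 0 := by simp [Fin.ext_iff]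
  refine ⟨?_, ?_, ?_⟩
  · rw [classSize, Finset.card_eq_one]
    refine ⟨0, ?_⟩
    ext a
    simp [cwClass_eq_zero_iff]
  · have hset : (Finset.univ.filter fun a : Fin (q + 2) => cwClass q a = 1) =
        Finset.univ \ {0, Fin.last (q + 1)} := by
      ext a
      simp [cwClass_eq_one_iff]
    rw [classSize, hset, Finset.card_sdiff_of_subset (Finset.subset_univ _), Finset.card_univ,
      Fintype.card_fin, Finset.card_pair hl.symm]
    omega
  · rw [classSize, Finset.card_eq_one]
    refine ⟨Fin.last (q + 1), ?_⟩
    ext a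
    simp [cwClass_eq_two_iff]

variable {K : Type u} [Field K]

/-- **Support of `CW_q`**: every term `x_a y_b z_c` of `CW_q` has classes summing to `2`
(blocks `002, 020, 200, 011, 101, 110`, Alman 2021, §4.1). [cite: Alman2021, §4.1] -/
theorem cwClass_sum_eq_two_of_ne_zero (q : ℕ) {a b c : Fin (q + 2)} (h : bigCwTensor K q a b c ≠ 0) :
    (cwClass q a : ℕ) + (cwClass q b : ℕ) + (cwClass q c : ℕ) = 2 := by
  have hl : (Fin.last (q + 1) : Fin (q + 2)) ≠ 0 := by simp [Fin.ext_iff]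
  rw [bigCwTensor_apply] at h
  split_ifs at h with hcond
  · rcases hcond with ⟨rfl, rfl, h3, h4⟩ | ⟨rfl, rfl, h3, h4⟩ | ⟨rfl, rfl, h3, h4⟩ |
        ⟨rfl, rfl, rfl⟩ | ⟨rfl, rfl, rfl⟩ | ⟨rfl, rfl, rfl⟩
    · simp [cwClass, h3, h4]
    · simp [cwClass, h3, h4]
    · simp [cwClass, h3, h4]
    · simp [cwClass, hl]
    · simp [cwClass, hl]
    · simp [cwClass, hl]
  · exact absurd rfl h

/-- `CW_q` is a `0/1` tensor. [cite: Alman2021, §4.1] -/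
theorem bigCwTensor_eq_one_of_ne_zero (q : ℕ) {a b c : Fin (q + 2)} (h : bigCwTensor K q a b c ≠ 0) :
    bigCwTensor K q a b c = 1 := by
  rw [bigCwTensor_apply] at h ⊢
  split_ifs at h ⊢ with hcond
  · rfl
  · exact absurd rfl h

/-- Support of a power of `CW_q`: every coordinate is a term of `CW_q`. [cite: Alman2021, Thm. 3.4 (proof)] -/
theorem cwPow_support (q m : ℕ) {A B C : Fin m → Fin (q + 2)}
    (h : kroneckerPow (bigCwTensor K q) m A B C ≠ 0) (i : Fin m) :
    (cwClass q (A i) : ℕ) + (cwClass q (B i) : ℕ) + (cwClass q (C i) : ℕ) = 2 := by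
  rw [kroneckerPow_apply, Finset.prod_ne_zero_iff] at h
  exact cwClass_sum_eq_two_of_ne_zero q (h i (Finset.mem_univ _))

/-- A power of `CW_q` is a `0/1` tensor. [cite: Alman2021, Thm. 3.4 (proof)] -/
theorem cwPow_eq_one_of_ne_zero (q m : ℕ) {A B C : Fin m → Fin (q + 2)}
    (h : kroneckerPow (bigCwTensor K q) m A B C ≠ 0) : kroneckerPow (bigCwTensor K q) m A B C = 1 := by
  rw [kroneckerPow_apply, Finset.prod_ne_zero_iff] at h
  rw [kroneckerPow_apply]
  exact Finset.prod_eq_one fun i _ => bigCwTensor_eq_one_of_ne_zero q (h i (Finset.mem_univ _))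

/-- Per-position class bookkeeping: with class sum `2`, the classes are a permutation of
`(2,0,0)` or of `(1,1,0)`. [folklore] -/
theorem class_indicator_identities :
    ∀ c₁ c₂ c₃ : Fin 3, (c₁ : ℕ) + c₂ + c₃ = 2 →
      ((if c₁ = 1 then 1 else 0) + (if c₂ = 1 then 1 else 0) + (if c₃ = 1 then 1 else 0) +
        2 * ((if c₁ = 2 then 1 else 0) + (if c₂ = 2 then 1 else 0) + (if c₃ = 2 then 1 else 0)) = 2 ∧
      (if c₁ = 0 then 1 else 0) + (if c₂ = 0 then 1 else 0) + (if c₃ = 0 then 1 else 0) =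
        1 + ((if c₁ = 2 then 1 else 0) + (if c₂ = 2 then 1 else 0) + (if c₃ = 2 then 1 else 0))) := by
  decide

/-- **Total class counts on the support of `CW_q^{⊗m}`**: if `S_c` is the number of corner
blocks (positions using a class-`2` variable), then over the three directions class `2` is used
`S_c` times, class `1` `2(m - S_c)` times and class `0` `m + S_c` times (Alman 2021, §4.1:
symmetric distributions `(v, v, v, 1/3-v, 1/3-v, 1/3-v)` on the six blocks).
[cite: Alman2021, §4.1] -/
theorem cwPow_wordType_sums (q m : ℕ) {A B C : Fin m → Fin (q + 2)}
    (h : kroneckerPow (bigCwTensor K q) m A B C ≠ 0) :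
    let Sc := wordType (cwClass q) A 2 + wordType (cwClass q) B 2 + wordType (cwClass q) C 2
    wordType (cwClass q) A 1 + wordType (cwClass q) B 1 + wordType (cwClass q) C 1 + 2 * Sc = 2 * m ∧
    wordType (cwClass q) A 0 + wordType (cwClass q) B 0 + wordType (cwClass q) C 0 = m + Sc ∧
    Sc ≤ m := by
  intro Sc
  have hpos := fun i => class_indicator_identities (cwClass q (A i)) (cwClass q (B i)) (cwClass q (C i))
    (cwPow_support q m h i)
  have e1 : wordType (cwClass q) A 1 + wordType (cwClass q) B 1 + wordType (cwClass q) C 1 + 2 * Sc =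
      ∑ i : Fin m, (((if cwClass q (A i) = 1 then 1 else 0) + (if cwClass q (B i) = 1 then 1 else 0) +
        (if cwClass q (C i) = 1 then 1 else 0)) +
        2 * ((if cwClass q (A i) = 2 then 1 else 0) + (if cwClass q (B i) = 2 then 1 else 0) +
          (if cwClass q (C i) = 2 then 1 else 0))) := by
    simp only [Sc, wordType_eq_sum, Finset.sum_add_distrib, Finset.mul_sum, mul_add]
  have e0 : wordType (cwClass q) A 0 + wordType (cwClass q) B 0 + wordType (cwClass q) C 0 =
      ∑ i : Fin m, ((if cwClass q (A i) = 0 then 1 else 0) + (if cwClass q (B i) = 0 then 1 else 0) +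
        (if cwClass q (C i) = 0 then 1 else 0)) := by
    simp only [wordType_eq_sum, Finset.sum_add_distrib]
  have eS : Sc = ∑ i : Fin m, ((if cwClass q (A i) = 2 then 1 else 0) + (if cwClass q (B i) = 2 then 1 else 0) +
      (if cwClass q (C i) = 2 then 1 else 0)) := by
    simp only [Sc, wordType_eq_sum, Finset.sum_add_distrib]
  refine ⟨?_, ?_, ?_⟩
  · rw [e1, Finset.sum_congr rfl fun i _ => (hpos i).1, Finset.sum_const, Finset.card_univ,
      Fintype.card_fin, smul_eq_mul, mul_comm]
  · rw [e0, Finset.sum_congr rfl fun i _ => (hpos i).2, Finset.sum_add_distrib, Finset.sum_const,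
      Finset.card_univ, Fintype.card_fin, smul_eq_mul, mul_one, ← eS]
  · have : 2 * Sc ≤ 2 * m := by
      have h1 : wordType (cwClass q) A 1 + wordType (cwClass q) B 1 + wordType (cwClass q) C 1 + 2 * Sc = 2 * m := by
        rw [e1, Finset.sum_congr rfl fun i _ => (hpos i).1, Finset.sum_const, Finset.card_univ,
          Fintype.card_fin, smul_eq_mul, mul_comm]
      omega
    omega

/-- Every word has `Σ_k type_k = m`. [folklore] -/
theorem sum_wordType {X : Type*} (cl : X → Fin 3) {m : ℕ} (A : Fin m → X) : ∑ k, wordType cl A k = m := by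
  unfold wordType
  rw [← Finset.card_eq_sum_card_fiberwise (f := fun i => cl (A i)) (t := Finset.univ)
    (fun i _ => Finset.mem_univ _), Finset.card_univ, Fintype.card_fin]

/-- **The base `g_q(v)`** of Alman's bound `S̃(CW_q) ≤ sup_{v ∈ [0,1/3]} g_q(v)`:
`g_q(v) = q^{2/3-2v} / (v^v (2/3-2v)^{2/3-2v} (1/3+v)^{1/3+v})`, written as
`(1/(1/3+v))^{1/3+v} (q/(2/3-2v))^{2/3-2v} (1/v)^v` (real powers; `0^0 = 1`). [cite: Alman2021, §4.1] -/
def cwBase (q : ℕ) (v : ℝ) : ℝ :=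
  (1 / (1 / 3 + v)) ^ (1 / 3 + v) * ((q : ℝ) / (2 / 3 - 2 * v)) ^ (2 / 3 - 2 * v) * (1 / v) ^ v

/-- `g_q(v) ≥ 0`. [cite: Alman2021, §4.1] -/
theorem cwBase_nonneg (q : ℕ) {v : ℝ} (hv : v ∈ Set.Icc (0 : ℝ) (1 / 3)) : 0 ≤ cwBase q v := by
  unfold cwBase
  have h1 : 0 ≤ 1 / 3 + v := by linarith [hv.1]
  have h2 : 0 ≤ 2 / 3 - 2 * v := by linarith [hv.2]
  exact mul_nonneg (mul_nonneg (Real.rpow_nonneg (by positivity) _)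
    (Real.rpow_nonneg (div_nonneg (Nat.cast_nonneg _) h2) _)) (Real.rpow_nonneg (by
      rcases hv.1.eq_or_lt with h | h
      · rw [← h]; simp
      · positivity) _)

/-- The number of words with the same class type as `A`. [cite: Alman2021, Thm. 3.4 (proof)] -/
def typeCount (q : ℕ) {m : ℕ} (A : Fin m → Fin (q + 2)) : ℕ :=
  (Finset.univ.filter fun A' : Fin m → Fin (q + 2) => wordType (cwClass q) A' = wordType (cwClass q) A).card

/-- **The per-triple bound** (the heart of Alman's Thm. 3.4 / Prop. 3.8 for `CW_q`, in finite
form): for `(A,B,C)` in the support of `CW_q^{⊗m}` with `S_c` corner positions, the least of the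
three numbers `#{A' | type A' = type A}`, `#{B' | …}`, `#{C' | …}` is at most `g_q(S_c/(3m))^m`.
(Weight-count each direction with the averaged class distribution
`π̄ = ((m+S_c)/3m, 2(m-S_c)/3m, S_c/3m) = (1/3+v, 2/3-2v, v)`; the product of the three bounds is
`g_q(v)^{3m}`.) [cite: Alman2021, Prop. 3.8] -/
theorem min_typeCount_le_cwBase_pow (q m : ℕ) (hm : 0 < m) {A B C : Fin m → Fin (q + 2)}
    (h : kroneckerPow (bigCwTensor K q) m A B C ≠ 0) :
    (min (typeCount q A) (min (typeCount q B) (typeCount q C)) : ℝ) ≤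
      cwBase q ((wordType (cwClass q) A 2 + wordType (cwClass q) B 2 + wordType (cwClass q) C 2 : ℕ) /
        (3 * m)) ^ m := by
  set ηA := wordType (cwClass q) A with hηA
  set ηB := wordType (cwClass q) B with hηB
  set ηC := wordType (cwClass q) C with hηC
  set n : Fin 3 → ℕ := fun k => ηA k + ηB k + ηC k with hn
  set Sc := ηA 2 + ηB 2 + ηC 2 with hSc
  obtain ⟨h1, h0, hScm⟩ := cwPow_wordType_sums q m h
  have hm0 : (0 : ℝ) < m := by exact_mod_cast hm
  have h3m : (0 : ℝ) < 3 * m := by positivity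
  -- the averaged distribution
  set π : Fin 3 → ℝ := fun k => (n k : ℝ) / (3 * m) with hπ
  have hπ0 : ∀ k, 0 ≤ π k := fun k => by positivity
  have hsum_n : ∑ k, n k = 3 * m := by
    simp only [hn, Finset.sum_add_distrib, hηA, hηB, hηC, sum_wordType]
    ring
  have hπ1 : ∑ k, π k ≤ 1 := by
    rw [hπ]
    simp only
    rw [← Finset.sum_div, ← Nat.cast_sum, hsum_n]
    push_cast
    rw [div_self h3m.ne']
  have hposA : ∀ k, ηA k ≠ 0 → 0 < π k := fun k hk => by
    have : 0 < n k := by rw [hn]; dsimp only; omega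
    positivity
  have hposB : ∀ k, ηB k ≠ 0 → 0 < π k := fun k hk => by
    have : 0 < n k := by rw [hn]; dsimp only; omega
    positivity
  have hposC : ∀ k, ηC k ≠ 0 → 0 < π k := fun k hk => by
    have : 0 < n k := by rw [hn]; dsimp only; omega
    positivity
  have bA : (typeCount q A : ℝ) ≤ ∏ k, ((classSize (cwClass q) k : ℝ) / π k) ^ ηA k :=
    card_wordType_le (cwClass q) π hπ0 hπ1 ηA hposA (m := m)
  have bB : (typeCount q B : ℝ) ≤ ∏ k, ((classSize (cwClass q) k : ℝ) / π k) ^ ηB k :=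
    card_wordType_le (cwClass q) π hπ0 hπ1 ηB hposB (m := m)
  have bC : (typeCount q C : ℝ) ≤ ∏ k, ((classSize (cwClass q) k : ℝ) / π k) ^ ηC k :=
    card_wordType_le (cwClass q) π hπ0 hπ1 ηC hposC (m := m)
  set x : Fin 3 → ℝ := fun k => (classSize (cwClass q) k : ℝ) / π k with hx
  have hx0 : ∀ k, 0 ≤ x k := fun k => div_nonneg (Nat.cast_nonneg _) (hπ0 k)
  -- the product of the three bounds is `(Π_k x_k^{π_k})^{3m}`
  have hprod : (∏ k, x k ^ ηA k) * (∏ k, x k ^ ηB k) * (∏ k, x k ^ ηC k) = (∏ k, x k ^ π k) ^ (3 * m) := by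
    rw [← Finset.prod_mul_distrib, ← Finset.prod_mul_distrib, ← Finset.prod_pow]
    refine Finset.prod_congr rfl fun k _ => ?_
    rw [← pow_add, ← pow_add, ← Real.rpow_mul_natCast (hx0 k)]
    have : π k * ((3 * m : ℕ) : ℝ) = ((ηA k + ηB k + ηC k : ℕ) : ℝ) := by
      rw [hπ, hn]
      push_cast
      field_simp
    rw [this, Real.rpow_natCast]
  -- identify `Π_k x_k^{π_k}` with `g_q(v)`
  obtain ⟨c0, c1, c2⟩ := classSize_cwClass q
  have hv0 : π 0 = 1 / 3 + (Sc : ℝ) / (3 * m) := by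
    rw [hπ, hn]; dsimp only
    have : ((ηA 0 + ηB 0 + ηC 0 : ℕ) : ℝ) = m + Sc := by rw [hSc]; exact_mod_cast h0
    rw [this]; field_simp
  have hv1 : π 1 = 2 / 3 - 2 * ((Sc : ℝ) / (3 * m)) := by
    rw [hπ, hn]; dsimp only
    have : ((ηA 1 + ηB 1 + ηC 1 : ℕ) : ℝ) = 2 * m - 2 * Sc := by
      have := congrArg (Nat.cast (R := ℝ)) h1
      push_cast at this
      rw [hSc]; push_cast; linarith
    rw [this]; field_simp
  have hv2 : π 2 = (Sc : ℝ) / (3 * m) := by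
    rw [hπ, hn]
  have hG : (∏ k, x k ^ π k) = cwBase q ((Sc : ℝ) / (3 * m)) := by
    rw [Fin.prod_univ_three, cwBase, hx]
    dsimp only
    rw [c0, c1, c2, hv0, hv1, hv2]
    push_cast
    ring_nf
  -- conclude
  have hG0 : 0 ≤ cwBase q ((Sc : ℝ) / (3 * m)) := by
    rw [← hG]; exact Finset.prod_nonneg fun k _ => Real.rpow_nonneg (hx0 k) _
  have hPA : 0 ≤ ∏ k, x k ^ ηA k := Finset.prod_nonneg fun k _ => pow_nonneg (hx0 k) _
  have hPB : 0 ≤ ∏ k, x k ^ ηB k := Finset.prod_nonneg fun k _ => pow_nonneg (hx0 k) _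
  set M := (min (typeCount q A) (min (typeCount q B) (typeCount q C)) : ℕ) with hM
  have hMA : (M : ℝ) ≤ typeCount q A := by exact_mod_cast min_le_left _ _
  have hMB : (M : ℝ) ≤ typeCount q B := by exact_mod_cast (min_le_right _ _).trans (min_le_left _ _)
  have hMC : (M : ℝ) ≤ typeCount q C := by exact_mod_cast (min_le_right _ _).trans (min_le_right _ _)
  have hM0 : (0 : ℝ) ≤ M := Nat.cast_nonneg _
  have key : (M : ℝ) ^ 3 ≤ (cwBase q ((Sc : ℝ) / (3 * m)) ^ m) ^ 3 := by
    have eA := hMA.trans bA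
    have eB := hMB.trans bB
    have eC := hMC.trans bC
    calc (M : ℝ) ^ 3 = (M : ℝ) * M * M := by ring
      _ ≤ (∏ k, x k ^ ηA k) * (∏ k, x k ^ ηB k) * (∏ k, x k ^ ηC k) :=
          mul_le_mul (mul_le_mul eA eB hM0 hPA) eC hM0 (mul_nonneg hPA hPB)
      _ = (cwBase q ((Sc : ℝ) / (3 * m)) ^ m) ^ 3 := by rw [hprod, hG, pow_mul']
  have := le_of_pow_le_pow_left₀ (by norm_num : (3 : ℕ) ≠ 0) (pow_nonneg hG0 m) key
  push_cast [hM] at this ⊢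
  exact this

/-! ## The finite slice-rank bound for powers of `CW_q` (Alman 2021, Thm. 3.4 and §4.1, finite form) -/

/-- The number of class types of words of length `m` is at most `(m+1)³`. [folklore] -/
theorem card_image_wordType_le (q m : ℕ) :
    ((Finset.univ.image fun A : Fin m → Fin (q + 2) => wordType (cwClass q) A).card : ℝ) ≤ ((m : ℝ) + 1) ^ 3 := by
  classical
  have hsub : (Finset.univ.image fun A : Fin m → Fin (q + 2) => wordType (cwClass q) A) ⊆
      Finset.univ.image (fun f : Fin 3 → Fin (m + 1) => fun k => ((f k : Fin (m + 1)) : ℕ)) := by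
    intro η hη
    obtain ⟨A, -, rfl⟩ := Finset.mem_image.1 hη
    refine Finset.mem_image.2 ⟨fun k => ⟨wordType (cwClass q) A k, Nat.lt_succ_of_le ?_⟩, Finset.mem_univ _, rfl⟩
    calc wordType (cwClass q) A k ≤ ∑ k, wordType (cwClass q) A k :=
          Finset.single_le_sum (fun k _ => Nat.zero_le _) (Finset.mem_univ k)
      _ = m := sum_wordType _ A
  have h1 := Finset.card_le_card hsub
  have h2 : (Finset.univ.image (fun f : Fin 3 → Fin (m + 1) => fun k => ((f k : Fin (m + 1)) : ℕ))).card ≤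
      (m + 1) ^ 3 := by
    refine (Finset.card_image_le).trans ?_
    simp [Fintype.card_fin]
  have : ((Finset.univ.image fun A : Fin m → Fin (q + 2) => wordType (cwClass q) A).card : ℝ) ≤ ((m + 1) ^ 3 : ℕ) := by
    exact_mod_cast h1.trans h2
  push_cast at this
  exact this

/-- The number of words whose type count is at most `M` is at most `(m+1)³ M`. [folklore] -/
theorem card_typeCount_le (q m : ℕ) {M : ℝ} (hM : 0 ≤ M) :
    ((Finset.univ.filter fun A : Fin m → Fin (q + 2) => (typeCount q A : ℝ) ≤ M).card : ℝ) ≤ ((m : ℝ) + 1) ^ 3 * M := by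
  classical
  set types := Finset.univ.image fun A : Fin m → Fin (q + 2) => wordType (cwClass q) A with htypes
  have hfib := Finset.card_eq_sum_card_fiberwise (f := fun A : Fin m → Fin (q + 2) => wordType (cwClass q) A)
    (s := Finset.univ.filter fun A : Fin m → Fin (q + 2) => (typeCount q A : ℝ) ≤ M) (t := types)
    (fun A _ => Finset.mem_image_of_mem _ (Finset.mem_univ A))
  have hbound : ∀ η ∈ types, (((Finset.univ.filter fun A : Fin m → Fin (q + 2) => (typeCount q A : ℝ) ≤ M).filter
      fun A => wordType (cwClass q) A = η).card : ℝ) ≤ M := by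
    intro η _
    by_cases hη : ((Finset.univ.filter fun A' : Fin m → Fin (q + 2) => wordType (cwClass q) A' = η).card : ℝ) ≤ M
    · refine le_trans ?_ hη
      exact_mod_cast Finset.card_le_card (fun A hA => by
        simp only [Finset.mem_filter, Finset.mem_univ, true_and] at hA ⊢
        exact hA.2)
    · have : ((Finset.univ.filter fun A : Fin m → Fin (q + 2) => (typeCount q A : ℝ) ≤ M).filter
          fun A => wordType (cwClass q) A = η) = ∅ := by
        rw [Finset.filter_eq_empty_iff]
        intro A hA hAη
        have hA' := (Finset.mem_filter.1 hA).2
        rw [typeCount, hAη] at hA'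
        exact hη hA'
      rw [this, Finset.card_empty, Nat.cast_zero]
      exact hM
  calc ((Finset.univ.filter fun A : Fin m → Fin (q + 2) => (typeCount q A : ℝ) ≤ M).card : ℝ)
      = ∑ η ∈ types, (((Finset.univ.filter fun A : Fin m → Fin (q + 2) => (typeCount q A : ℝ) ≤ M).filter
          fun A => wordType (cwClass q) A = η).card : ℝ) := by rw [hfib]; push_cast; rfl
    _ ≤ ∑ _η ∈ types, M := Finset.sum_le_sum hbound
    _ = (types.card : ℝ) * M := by rw [Finset.sum_const, nsmul_eq_mul]
    _ ≤ ((m : ℝ) + 1) ^ 3 * M := mul_le_mul_of_nonneg_right (card_image_wordType_le q m) hM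

open Literature.Combinatorics.Additive in
/-- **Finite form of Alman's slice-rank bound for `CW_q`** (Thm. 3.4 with the partition of §4.1
and Prop. 3.8): if `g_q(v) ≤ B` for all `v ∈ [0, 1/3]` then
`S(CW_q^{⊗m}) ≤ 3 (1 + (m+1)³ Bᵐ)` for every `m ≥ 1`. (Alman's `S̃(CW_q) ≤ sup_v g_q(v)`
is the `m`-th-root asymptotics of this.) Proof: cover the support of `CW_q^{⊗m}` by the three
families of words whose type count is `≤ Bᵐ` (`hasSliceRankLE_of_cover`): by
`min_typeCount_le_cwBase_pow` every support triple has such a word among its coordinates.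
[cite: Alman2021, Thm. 3.4] -/
theorem sliceRank_cwPow_le (q m : ℕ) (hm : 0 < m) (B : ℝ)
    (hB : ∀ v ∈ Set.Icc (0 : ℝ) (1 / 3), cwBase q v ≤ B) :
    (sliceRank (kroneckerPow (bigCwTensor K q) m) : ℝ) ≤ 3 * (1 + ((m : ℝ) + 1) ^ 3 * B ^ m) := by
  classical
  set T := kroneckerPow (bigCwTensor K q) m with hT
  have hB0 : 0 ≤ B := (cwBase_nonneg q (v := 0) ⟨le_rfl, by norm_num⟩).trans (hB 0 ⟨le_rfl, by norm_num⟩)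
  have hBm : 0 ≤ B ^ m := pow_nonneg hB0 m
  -- every support triple has a coordinate with small type count
  have hgood : ∀ A B' C : Fin m → Fin (q + 2), T A B' C ≠ 0 →
      (typeCount q A : ℝ) ≤ B ^ m ∨ (typeCount q B' : ℝ) ≤ B ^ m ∨ (typeCount q C : ℝ) ≤ B ^ m := by
    intro A B' C h
    have h1 := min_typeCount_le_cwBase_pow q m hm h
    obtain ⟨-, -, hScm⟩ := cwPow_wordType_sums q m h
    have hv : ((wordType (cwClass q) A 2 + wordType (cwClass q) B' 2 + wordType (cwClass q) C 2 : ℕ) : ℝ) /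
        (3 * m) ∈ Set.Icc (0 : ℝ) (1 / 3) := by
      have hm0 : (0 : ℝ) < m := by exact_mod_cast hm
      constructor
      · positivity
      · rw [div_le_iff₀ (by positivity)]
        have : ((wordType (cwClass q) A 2 + wordType (cwClass q) B' 2 + wordType (cwClass q) C 2 : ℕ) : ℝ) ≤ m := by
          exact_mod_cast hScm
        linarith
    have h2 : (min (typeCount q A) (min (typeCount q B') (typeCount q C)) : ℝ) ≤ B ^ m :=
      h1.trans (pow_le_pow_left₀ (cwBase_nonneg q hv) (hB _ hv) m)
    by_contra hall
    push Not at hall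
    obtain ⟨hA, hB', hC⟩ := hall
    have : B ^ m < (min (typeCount q A) (min (typeCount q B') (typeCount q C)) : ℝ) :=
      lt_min hA (lt_min hB' hC)
    linarith
  -- the covering families
  set S := Option {A : Fin m → Fin (q + 2) // (typeCount q A : ℝ) ≤ B ^ m} with hS
  set Ω := {ω : (Fin m → Fin (q + 2)) × (Fin m → Fin (q + 2)) × (Fin m → Fin (q + 2)) //
    T ω.1 ω.2.1 ω.2.2 ≠ 0} with hΩ
  set πo : (Fin m → Fin (q + 2)) → S := fun A =>
    if h : (typeCount q A : ℝ) ≤ B ^ m then some ⟨A, h⟩ else none with hπo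
  set φ : S → (Fin m → Fin (q + 2)) → K := fun s =>
    Option.elim s (fun _ => 0) (fun p x => if x = p.1 then 1 else 0) with hφ
  have hφπ : ∀ A, (typeCount q A : ℝ) ≤ B ^ m → φ (πo A) = fun x => if x = A then 1 else 0 := by
    intro A hA
    simp only [hφ, hπo, dif_pos hA, Option.elim_some]
  have hcover : HasSliceRankLE T (Fintype.card S + Fintype.card S + Fintype.card S) := by
    refine hasSliceRankLE_of_cover (Ω := Ω) T (fun ω x => if x = ω.1.1 then 1 else 0)
      (fun ω y => if y = ω.1.2.1 then 1 else 0) (fun ω z => if z = ω.1.2.2 then 1 else 0) ?_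
      (fun ω => if (typeCount q ω.1.1 : ℝ) ≤ B ^ m then 0
        else if (typeCount q ω.1.2.1 : ℝ) ≤ B ^ m then 1 else 2)
      (fun ω => πo ω.1.1) φ ?_ (fun ω => πo ω.1.2.1) φ ?_ (fun ω => πo ω.1.2.2) φ ?_
    · -- `T = Σ_ω e_A ⊗ e_B ⊗ e_C`
      intro x y z
      by_cases hxyz : T x y z = 0
      · rw [hxyz]
        refine (Finset.sum_eq_zero fun ω _ => ?_).symm
        have hne : (ω : _).1 ≠ (x, y, z) := fun e => ω.2 (by rw [e]; exact hxyz)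
        by_cases h1 : x = ω.1.1
        · by_cases h2 : y = ω.1.2.1
          · have h3 : z ≠ ω.1.2.2 := fun h3 => hne (by ext <;> simp [h1, h2, h3])
            simp [h3]
          · simp [h2]
        · simp [h1]
      · have hone : T x y z = 1 := cwPow_eq_one_of_ne_zero q m hxyz
        rw [Finset.sum_eq_single ⟨(x, y, z), hxyz⟩]
        · simp [hone]
        · intro ω _ hω
          have hne : (ω : _).1 ≠ (x, y, z) := fun e => hω (Subtype.ext e)
          by_cases h1 : x = ω.1.1
          · by_cases h2 : y = ω.1.2.1
            · have h3 : z ≠ ω.1.2.2 := fun h3 => hne (by ext <;> simp [h1, h2, h3])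
              simp [h3]
            · simp [h2]
          · simp [h1]
        · simp
    · intro ω hω
      have hA : (typeCount q ω.1.1 : ℝ) ≤ B ^ m := by
        by_contra hA
        rw [if_neg hA] at hω
        split_ifs at hω <;> exact absurd hω (by decide)
      exact (hφπ _ hA).symm
    · intro ω hω
      have hB' : (typeCount q ω.1.2.1 : ℝ) ≤ B ^ m := by
        by_cases hA : (typeCount q ω.1.1 : ℝ) ≤ B ^ m
        · rw [if_pos hA] at hω; exact absurd hω (by decide)
        · by_contra hB'
          rw [if_neg hA, if_neg hB'] at hω
          exact absurd hω (by decide)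
      exact (hφπ _ hB').symm
    · intro ω hω
      have hC : (typeCount q ω.1.2.2 : ℝ) ≤ B ^ m := by
        by_cases hA : (typeCount q ω.1.1 : ℝ) ≤ B ^ m
        · rw [if_pos hA] at hω; exact absurd hω (by decide)
        · by_cases hB' : (typeCount q ω.1.2.1 : ℝ) ≤ B ^ m
          · rw [if_neg hA, if_pos hB'] at hω; exact absurd hω (by decide)
          · rcases hgood _ _ _ ω.2 with h | h | h
            · exact absurd h hA
            · exact absurd h hB'
            · exact h
      exact (hφπ _ hC).symm
  -- count
  have hcard : (Fintype.card S : ℝ) ≤ 1 + ((m : ℝ) + 1) ^ 3 * B ^ m := by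
    show (Fintype.card (Option {A : Fin m → Fin (q + 2) // (typeCount q A : ℝ) ≤ B ^ m}) : ℝ) ≤ _
    rw [Fintype.card_option, Fintype.card_subtype]
    push_cast
    linarith [card_typeCount_le q m hBm]
  have h1 := hcover.sliceRank_le
  calc (sliceRank T : ℝ) ≤ ((Fintype.card S + Fintype.card S + Fintype.card S : ℕ) : ℝ) := by exact_mod_cast h1
    _ = 3 * (Fintype.card S : ℝ) := by push_cast; ring
    _ ≤ 3 * (1 + ((m : ℝ) + 1) ^ 3 * B ^ m) := by linarith

end CwSupport




end Literature.Barriers.MatrixMultiplication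

end
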